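import Summits.ValiantsHypothesis.ValiantsHypothesis.Theses.HartogsRankTwo

/-!
# ValiantsHypothesis / HartogsRankTwo — item `TradeoffToHartogs` (stmt-ValiantsHypothesis-10338), closed

`PoleOrderTradeoff → HartogsTwo`: the trade-off at pole order `N = 0` and size `n + 2` gives, for every
representative `Q` of `per_{n+2}` on `D_2`, `n ≤ C (log₂ L(Q) + 1)`; a family of representatives of
complexity `≤ (n+2)^c + c ≤ (n+2)^{c+1}` would give `n ≤ C((c+1) log₂(n+2) + 1)` for all `n`, which
fails at `n + 2 = 2^t` for `t = K + K² + (C + 2)`, `K = C(c+1)` (`2^t > K t + C + 2`, from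
`2^x ≥ x + 1`). ℕ-arithmetic. HONEST FRAMING: bookkeeping; `PoleOrderTradeoff` is an OPEN crux;
nothing here is progress on `VP ≠ VNP`.
-/

-- layout Summits/ValiantsHypothesis/ValiantsHypothesis forces the duplicated namespace component
set_option linter.dupNamespace false

namespace Summit.ValiantsHypothesis.ValiantsHypothesis.Theorems.HartogsRankTwo

open Literature.Computability.AlgebraicComplexity

/-- Exponential beats linear: `K t + B < 2^t` at `t = K + (K² + B)` (from `x + 1 ≤ 2^x`). [folklore] -/
private theorem linear_lt_two_pow (K B : ℕ) : K * (K + (K * K + B)) + B < 2 ^ (K + (K * K + B)) := by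
  have h1 : K + 1 ≤ 2 ^ K := Nat.lt_two_pow_self
  have h2 : K * K + B + 1 ≤ 2 ^ (K * K + B) := Nat.lt_two_pow_self
  have h3 : (K + 1) * (K * K + B + 1) ≤ 2 ^ (K + (K * K + B)) := by
    rw [pow_add]; exact Nat.mul_le_mul h1 h2
  nlinarith

/-- **Item `TradeoffToHartogs` (stmt-ValiantsHypothesis-10338):** `PoleOrderTradeoff → HartogsTwo`.
[folklore] -/
theorem tradeoffToHartogs_proof : Theses.HartogsRankTwo.TradeoffToHartogs := by
  unfold Theses.HartogsRankTwo.TradeoffToHartogs Theses.HartogsRankTwo.PoleOrderTradeoff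
    Theses.HartogsRankTwo.HartogsTwo
  rintro ⟨C, hC⟩ ⟨c, hc⟩
  -- the bad size: `n + 2 = 2^t`
  set K := C * (c + 1) with hK
  set t := K + (K * K + (C + 2)) with ht
  have ht2 : 2 ≤ t := by omega
  have h4 : 4 ≤ 2 ^ t := by
    calc 4 = 2 ^ 2 := by norm_num
      _ ≤ 2 ^ t := Nat.pow_le_pow_right (by norm_num) ht2
  set n := 2 ^ t - 2 with hn
  have hn2 : n + 2 = 2 ^ t := by omega
  obtain ⟨P, hP, hsize⟩ := hc (n + 2)
  -- the trade-off at pole order `0`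
  have hbound := hC n 0 P (fun U V => by rw [pow_zero, one_mul]; exact hP U V)
  -- `complexity P ≤ (n+2)^c + c ≤ (n+2)^(c+1) = 2^(t(c+1))`, so `log₂ (complexity P) ≤ t (c+1)`
  have hcpx : complexity P ≤ 2 ^ (t * (c + 1)) := by
    have h1 : (n + 2) ^ c + c ≤ (n + 2) ^ (c + 1) := by
      have hc' : c ≤ 2 ^ c := (Nat.lt_two_pow_self).le
      have h2c : 2 ^ c ≤ (n + 2) ^ c := Nat.pow_le_pow_left (by omega) c
      have : (n + 2) ^ (c + 1) = (n + 2) ^ c * (n + 2) := pow_succ _ _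
      nlinarith
    calc complexity P ≤ (n + 2) ^ c + c := hsize
      _ ≤ (n + 2) ^ (c + 1) := h1
      _ = 2 ^ (t * (c + 1)) := by rw [hn2, ← pow_mul]
  have hlog : Nat.log 2 (complexity P) ≤ t * (c + 1) :=
    calc Nat.log 2 (complexity P) ≤ Nat.log 2 (2 ^ (t * (c + 1))) := Nat.log_mono_right hcpx
      _ = t * (c + 1) := Nat.log_pow Nat.one_lt_two _
  -- `n ≤ C (t(c+1) + 1)`, against `2^t > K t + C + 2`
  have hle : n ≤ C * (t * (c + 1) + 1) :=
    hbound.trans (by simpa using Nat.mul_le_mul_left C (Nat.add_le_add_right hlog 1))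
  have hlt : K * t + (C + 2) < 2 ^ t := by
    have := linear_lt_two_pow K (C + 2)
    rwa [← ht] at this
  have hKt : C * (t * (c + 1) + 1) = K * t + C := by rw [hK]; ring
  omega

end Summit.ValiantsHypothesis.ValiantsHypothesis.Theorems.HartogsRankTwo
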